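import Summits.BirchSwinnertonDyer.Rank1Residual.Supersingular.MazurTateFunctionalEquation
import Summits.BirchSwinnertonDyer.Rank1Residual.Supersingular.MazurTateParityAlgebra
import Summits.BirchSwinnertonDyer.Rank1Residual.Supersingular.MazurTateCertificates
import Literature.Barriers.BirchSwinnertonDyer.PAdicFunctionalEquationParityProofs
import Mathlib.RingTheory.PowerSeries.Trunc
import HarnessLib

/-!
# Parity of the `λ`-invariant of a Mazur–Tate element: `(−1)^{λ(θ_n)} = −ε_N(f) = w_E`
# (cell `b2b-bsdres`, supersingular family, prover B = unit `b2b-bsdres-additive-p3`, gen 5; part 2/2)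

HONEST FRAMING (run/shared/lean/b2b/bsd-rank1-residual/, verbatim in every file): the goal of the
cell is to DELETE the COMBINATION-SHAPED residual classes of the Birch–Swinnerton-Dyer formula for
ALL analytic-rank `≤ 1` elliptic curves over `ℚ` — "full BSD formula for every rank `≤ 1` curve in
class `C`" assembled STRICTLY from published theorems — so that the rank-`≤ 1` remainder becomes
exactly the CONSTRUCTION-SHAPED classes, which are TYPED (missing-input `Prop`s), NOT attempted.
This is not "finishing BSD". THEOREMS ONLY (pure algebra + the tree's own theorems; no definition, no
named fact; nothing about any particular curve is asserted; nothing booked; labels unchanged).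

## What this file proves

Part 1 (`MazurTateFunctionalEquation.lean`) proved the functional equation of the Mazur–Tate
element `θ_n = θ_n(f, T) ∈ ℚ[T]` of a form `f ∈ S₂(Γ₀(N))` with `f(-1/(Nτ)) = -σ N τ² f(τ)`,
`σ = ±1`, at a prime `p ∤ N`: `ω_n ∣ θ_n(T) − σ (1+T)^c θ_n((1+T)^{pⁿ−1} − 1)` (Ota 2018, Prop. 5.16;
Mazur–Tate 1987). Here, for `p` ODD:

* (pure algebra, `MazurTateParityAlgebra.lean`): the coefficient of `T^λ`, `λ = ord_T θ̄`, in
  `(1+T)^c · θ̄((1+T)^{M−1} − 1)` is `(M−1)^λ · [T^λ]θ̄`; hence `T^M ∣ θ̄ − σ (1+T)^c θ̄((1+T)^{M−1} − 1)`,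
  `θ̄ ≠ 0`, `deg θ̄ < M` force `σ (M−1)^λ = 1`.
* §2–3 (transfer `ℚ[T] → ℤ_p[T] → 𝔽_p[T]`): for `Θ ∈ Λ = ℤ_p⟦T⟧` with `ι Θ = θ_n` (the Mazur–Tate
  element as an element of `Λ`, as in every certificate theorem of the cell), the functional equation
  descends to `ℤ_p[T]` (monic division) and reduces to `𝔽_p[T]`, where `ω_n ≡ T^{pⁿ}`.
* §4 **THE PARITY THEOREM** `neg_one_pow_lam_mazurTate`: if `Θ ≠ 0` and `μ(Θ) = 0` then
  **`(−1)^{λ(Θ)} = σ`** — the `λ`-invariant of a Mazur–Tate element with unit content has the parity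
  dictated by the Fricke sign (Ota 2018, p. 498: "the functional equation of `θ_S` implies that if
  `θ_S ∈ I^b ∖ I^{b+1}` … then `b ≡ ord_{s=1} L(E,s) mod 2`" is the `I`-adic relative of this
  statement; here `λ` is the Iwasawa invariant). Valid for EVERY odd prime `p ∤ N` — ordinary or
  supersingular, any `a_p` — and every layer `n`.
* §5 for the newform of an elliptic curve `E = W`: `σ = −ε_N(f)` at any level
  (`neg_one_pow_lam_mazurTate_eq_neg_frickeEigenvalue`), and at the conductor level `σ = w_E` with
  `w_E = (−1)^{ord_{s=1} L(E,s)}` (Hecke; tree theorems `rootNumber_eq_neg_frickeEigenvalue`,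
  `even_analyticRank_iff_of_isNewformOf_conductorLevel`), whence
  **`λ(θ_n) ≡ ord_{s=1} L(E, s) (mod 2)`** (`even_lam_mazurTate_iff_even_analyticRank`).

The consequences for the signed `p`-adic `L`-functions (`λ(L♯) ≡ λ(L♭) ≡ λ(L_p^±) ≡ r_an (mod 2)`,
via the gen-4 readings `λ(θ_n) = deg ω_n^± + λ(L^•)` with `deg ω_n^±` even) are drawn in
`SignedLambdaParity.lean`. CENSUS CHECK (iw-2 `tables/ss_signed_by_epsilon.tsv`, 825 X6/X7/X8 pairs ×
2 signs, all with `μ = 0`): `λ` even on all 1 428 analytic-rank-0 entries, odd on all 222 rank-1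
entries — 1 650/1 650 as the theorem predicts (memo `HOME/b2b-bsdres-additive-p3/X8-ROUTE-B.md` §10).

References: [Ota2018] K. Ota, Amer. J. Math. 140 (2018), Prop. 5.16 and p. 498; [MazurTate1987]
B. Mazur, J. Tate, Duke Math. J. 54 (1987); [GreenbergLNM1716] §1 pp. 67–68, §5 p. 181 (parity of the
order of `L_p` vs `L`); [Pollack2003] Def. 6.15, Rem. 6.16; [GreenbergVatsal2000] (1)–(2) (`μ`, `λ`).
-/

set_option autoImplicit false

noncomputable section

open scoped Classical MatrixGroups ModularForm

open CongruenceSubgroup Polynomial WeierstrassCurve Literature.NumberTheory.EllipticCurves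
  Literature.NumberTheory.EllipticCurves.ModularForms
  Summit.BirchSwinnertonDyer.Rank1Residual.X1.MuLambda

namespace Summit.BirchSwinnertonDyer.Rank1Residual.Supersingular

/-! ## §2. The Mazur–Tate element as a polynomial over `ℤ_p` -/

section Integral

variable {N : ℕ} {f : CuspForm (Gamma0 N) 2} {p : ℕ} [hp : Fact p.Prime]

/-- **`Θ` with `ι Θ = θ_n` is a polynomial of degree `< pⁿ` over `ℤ_p`**: its truncation below `pⁿ`
is `Θ` itself (the coefficients in degrees `≥ pⁿ` vanish, `coeff_eq_zero_of_iwasawaToPowerSeries_eq`).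
[cite: Pollack2003, Def. 6.15 and Remark 6.16] -/
theorem coe_trunc_eq_of_mazurTate {n : ℕ} {Θ : IwasawaAlgebra p}
    (hΘ : iwasawaToPowerSeries p Θ =
      ((mazurTateElement f p n).map (algebraMap ℚ ℚ_[p]) : PowerSeries ℚ_[p])) :
    ((PowerSeries.trunc (p ^ n) Θ : ℤ_[p][X]) : PowerSeries ℤ_[p]) = Θ := by
  ext i
  rw [Polynomial.coeff_coe, PowerSeries.coeff_trunc]
  split_ifs with hi
  · rfl
  · exact (coeff_eq_zero_of_iwasawaToPowerSeries_eq hΘ (not_lt.mp hi)).symm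

/-- The truncation maps to `θ_n` under `ℤ_p ↪ ℚ_p`: `(trunc Θ).map = θ_n.map` as polynomials.
[cite: Pollack2003, Def. 6.15 and Remark 6.16] -/
theorem map_trunc_eq_of_mazurTate {n : ℕ} {Θ : IwasawaAlgebra p}
    (hΘ : iwasawaToPowerSeries p Θ =
      ((mazurTateElement f p n).map (algebraMap ℚ ℚ_[p]) : PowerSeries ℚ_[p])) :
    (PowerSeries.trunc (p ^ n) Θ).map (algebraMap ℤ_[p] ℚ_[p]) =
      (mazurTateElement f p n).map (algebraMap ℚ ℚ_[p]) := by
  apply Polynomial.coe_injective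
  rw [Polynomial.polynomial_map_coe, coe_trunc_eq_of_mazurTate hΘ]
  exact hΘ

/-- The truncation has degree `< pⁿ`. [folklore] -/
theorem natDegree_trunc_lt (n : ℕ) (Θ : IwasawaAlgebra p) :
    (PowerSeries.trunc (p ^ n) Θ).natDegree < p ^ n := by
  have hpn : 0 < p ^ n := pow_pos hp.out.pos n
  by_cases h0 : PowerSeries.trunc (p ^ n) Θ = 0
  · rw [h0, natDegree_zero]; exact hpn
  · rw [natDegree_lt_iff_degree_lt h0]
    exact PowerSeries.degree_trunc_lt Θ (p ^ n)

/-- `red Θ` is the reduction of the truncation, as a power series. [folklore] -/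
theorem red_eq_coe_map_trunc_of_mazurTate {n : ℕ} {Θ : IwasawaAlgebra p}
    (hΘ : iwasawaToPowerSeries p Θ =
      ((mazurTateElement f p n).map (algebraMap ℚ ℚ_[p]) : PowerSeries ℚ_[p])) :
    red Θ = (((PowerSeries.trunc (p ^ n) Θ).map (IsLocalRing.residue ℤ_[p]) :
      (IsLocalRing.ResidueField ℤ_[p])[X]) : PowerSeries (IsLocalRing.ResidueField ℤ_[p])) := by
  rw [Polynomial.polynomial_map_coe, coe_trunc_eq_of_mazurTate hΘ]

end Integral

/-! ## §3. The functional equation in `ℤ_p[T]` and in `𝔽_p[T]` -/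

section Transfer

variable {N : ℕ} {f : CuspForm (Gamma0 N) 2} {p : ℕ} [hp : Fact p.Prime]

/-- **The functional equation descends to `ℤ_p[T]`**: for `Θ ∈ Λ` with `ι Θ = θ_n` and
`(σ, c)` as in `exists_cyclotomicOmega_dvd_mazurTateElement_sub`,
`(X+1)^{pⁿ} − 1 ∣ Θ − σ (X+1)^c Θ((X+1)^{pⁿ−1} − 1)` in `ℤ_p[X]` (`Θ` = its truncation below `pⁿ`):
map the rational congruence to `ℚ_p[X]` and divide by the monic `ω_n` inside `ℤ_p[X]`
(`dvd_of_map_dvd_map_of_injective`). [cite: Ota2018, Prop. 5.16] -/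
theorem omega_dvd_trunc_sub_of_mazurTate {σ : ℤ} {n c : ℕ}
    (hFE : (cyclotomicOmega p n).map (Int.castRingHom ℚ) ∣
      mazurTateElement f p n -
        C (σ : ℚ) * ((X + 1) ^ c * (mazurTateElement f p n).comp ((X + 1) ^ (p ^ n - 1) - 1)))
    {Θ : IwasawaAlgebra p}
    (hΘ : iwasawaToPowerSeries p Θ =
      ((mazurTateElement f p n).map (algebraMap ℚ ℚ_[p]) : PowerSeries ℚ_[p])) :
    ((X + 1 : ℤ_[p][X]) ^ p ^ n - 1) ∣
      PowerSeries.trunc (p ^ n) Θ -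
        C (σ : ℤ_[p]) * ((X + 1) ^ c *
          (PowerSeries.trunc (p ^ n) Θ).comp ((X + 1) ^ (p ^ n - 1) - 1)) := by
  set Θp : ℤ_[p][X] := PowerSeries.trunc (p ^ n) Θ with hΘp
  have hpn : 1 ≤ p ^ n := Nat.one_le_pow _ _ hp.out.pos
  -- push the rational functional equation to `ℚ_p[X]`
  have h1 := Polynomial.map_dvd (algebraMap ℚ ℚ_[p]) hFE
  rw [Polynomial.map_map] at h1
  have hω : ((cyclotomicOmega p n).map ((algebraMap ℚ ℚ_[p]).comp (Int.castRingHom ℚ))) =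
      (((X + 1 : ℤ_[p][X]) ^ p ^ n - 1)).map (algebraMap ℤ_[p] ℚ_[p]) := by
    rw [map_cyclotomicOmega]
    simp
  have hrhs : (mazurTateElement f p n -
        C (σ : ℚ) * ((X + 1) ^ c * (mazurTateElement f p n).comp ((X + 1) ^ (p ^ n - 1) - 1))).map
          (algebraMap ℚ ℚ_[p]) =
      (Θp - C (σ : ℤ_[p]) * ((X + 1) ^ c * Θp.comp ((X + 1) ^ (p ^ n - 1) - 1))).map
        (algebraMap ℤ_[p] ℚ_[p]) := by
    rw [Polynomial.map_sub, Polynomial.map_sub, Polynomial.map_mul, Polynomial.map_mul,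
      Polynomial.map_mul, Polynomial.map_mul, Polynomial.map_comp, Polynomial.map_comp,
      map_trunc_eq_of_mazurTate hΘ]
    simp
  rw [hω, hrhs] at h1
  exact dvd_of_map_dvd_map_of_injective (algebraMap ℤ_[p] ℚ_[p]) (IsFractionRing.injective ℤ_[p] ℚ_[p])
    (monic_X_add_one_pow_sub_one hpn) h1

/-- **… and reduces to `𝔽_p[T]`, where `ω_n ≡ T^{pⁿ}`**: with `Θ̄ = ` the reduction of (the truncation
of) `Θ`, `T^{pⁿ} ∣ Θ̄ − σ̄ (X+1)^c Θ̄((X+1)^{pⁿ−1} − 1)` in `𝔽_p[X]`. [cite: Ota2018, Prop. 5.16] -/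
theorem X_pow_dvd_reduction_sub_of_mazurTate {σ : ℤ} {n c : ℕ}
    (hFE : (cyclotomicOmega p n).map (Int.castRingHom ℚ) ∣
      mazurTateElement f p n -
        C (σ : ℚ) * ((X + 1) ^ c * (mazurTateElement f p n).comp ((X + 1) ^ (p ^ n - 1) - 1)))
    {Θ : IwasawaAlgebra p}
    (hΘ : iwasawaToPowerSeries p Θ =
      ((mazurTateElement f p n).map (algebraMap ℚ ℚ_[p]) : PowerSeries ℚ_[p])) :
    (X : (IsLocalRing.ResidueField ℤ_[p])[X]) ^ p ^ n ∣
      (PowerSeries.trunc (p ^ n) Θ).map (IsLocalRing.residue ℤ_[p]) -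
        C (σ : IsLocalRing.ResidueField ℤ_[p]) * ((X + 1) ^ c *
          ((PowerSeries.trunc (p ^ n) Θ).map (IsLocalRing.residue ℤ_[p])).comp
            ((X + 1) ^ (p ^ n - 1) - 1)) := by
  have h1 := Polynomial.map_dvd (IsLocalRing.residue ℤ_[p]) (omega_dvd_trunc_sub_of_mazurTate hFE hΘ)
  have hω : (((X + 1 : ℤ_[p][X]) ^ p ^ n - 1)).map (IsLocalRing.residue ℤ_[p]) =
      (X : (IsLocalRing.ResidueField ℤ_[p])[X]) ^ p ^ n := by
    rw [← map_cyclotomicOmega (Int.castRingHom ℤ_[p]) n, Polynomial.map_map,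
      map_residue_cyclotomicOmega]
  rw [hω] at h1
  simpa [Polynomial.map_sub, Polynomial.map_mul, Polynomial.map_comp] using h1

end Transfer

/-! ## §4. THE PARITY THEOREM -/

section Parity

variable {N : ℕ} [NeZero N] {f : CuspForm (Gamma0 N) 2} {p : ℕ} [hp : Fact p.Prime]

/-- **PARITY OF `λ(θ_n)` (the functional equation read modulo `p`).** Let `f ∈ S₂(Γ₀(N))` satisfy
`f(-1/(Nτ)) = -σ N τ² f(τ)` with `σ = ±1` (for the newform of an elliptic curve: `σ = −ε_N(f) = w_E`),
let `p ∤ N` be an ODD prime (any reduction type, any `a_p`), `n ≥ 0`, and let `Θ ∈ Λ = ℤ_p⟦T⟧`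
be the Mazur–Tate element `θ_n(f)` (`ι Θ = θ_n`) with `Θ ≠ 0` and `μ(Θ) = 0`. Then
**`(−1)^{λ(Θ)} = σ`.** Proof: the functional equation `θ_n ≡ σ (1+T)^c θ_n((1+T)^{−1} − 1) (mod ω_n)`
(part 1) holds in `ℤ_p[T]` and reduces to `𝔽_p[T]`, where `ω_n ≡ T^{pⁿ}` and the substitution
`T ↦ (1+T)^{pⁿ−1} − 1 = −T + …` multiplies the lowest coefficient `[T^λ]Θ̄ ≠ 0` by `(−1)^λ`
(`mul_pow_natTrailingDegree_eq_one_of_dvd`); `λ(Θ) = ord_T Θ̄`. (Ota 2018, p. 498, the `I`-adic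
analogue: "if `θ_S ∈ I^b ∖ I^{b+1}` … then `b ≡ ord_{s=1} L(E,s) mod 2`".)
[cite: Ota2018, Prop. 5.16 and p. 498] -/
theorem neg_one_pow_lam_mazurTate {σ : ℤ} (hσ : σ = 1 ∨ σ = -1)
    (hW : IsFrickeEigen N f (-(σ : ℂ))) (hp2 : p ≠ 2) (hpN : ¬ p ∣ N) {n : ℕ} {Θ : IwasawaAlgebra p}
    (hΘ : iwasawaToPowerSeries p Θ =
      ((mazurTateElement f p n).map (algebraMap ℚ ℚ_[p]) : PowerSeries ℚ_[p]))
    (hΘ0 : Θ ≠ 0) (hμ : mu Θ = 0) : (-1 : ℤ) ^ lam Θ = σ := by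
  have hσ2 : σ ^ 2 = 1 := by rcases hσ with rfl | rfl <;> norm_num
  obtain ⟨c, -, hFE⟩ := exists_cyclotomicOmega_dvd_mazurTateElement_sub hσ2 hW hpN n
  -- the reduction `Θ̄` of `Θ`
  set Θbar : (IsLocalRing.ResidueField ℤ_[p])[X] :=
    (PowerSeries.trunc (p ^ n) Θ).map (IsLocalRing.residue ℤ_[p]) with hΘbar
  have hred : red Θ = (Θbar : PowerSeries (IsLocalRing.ResidueField ℤ_[p])) :=
    red_eq_coe_map_trunc_of_mazurTate hΘ
  have hredne : red Θ ≠ 0 := red_ne_zero_of_mu_eq_zero hΘ0 hμ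
  have hΘbar0 : Θbar ≠ 0 := by
    intro h0
    exact hredne (by rw [hred, h0, Polynomial.coe_zero])
  have hdeg : Θbar.natDegree < p ^ n :=
    lt_of_le_of_lt (natDegree_map_le) (natDegree_trunc_lt n Θ)
  -- `λ(Θ) = ord_T Θ̄`
  have hlam : lam Θ = Θbar.natTrailingDegree := by
    obtain ⟨-, h⟩ := mu_eq_zero_and_lam_eq_of_red_ne_zero hredne
    rw [hred, order_coe_eq_natTrailingDegree hΘbar0] at h
    exact_mod_cast h
  -- the functional equation mod `(p, T^{pⁿ})` and the parity mechanism
  have hdvd := X_pow_dvd_reduction_sub_of_mazurTate hFE hΘ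
  have key := mul_pow_natTrailingDegree_eq_one_of_dvd hΘbar0 hdeg hdvd
  rw [← hlam] at key
  have hm1 : (-1 : IsLocalRing.ResidueField ℤ_[p]) ≠ 1 := neg_one_ne_one_residueField hp2
  rcases Nat.eq_zero_or_pos n with hn | hn
  · -- `n = 0`: `θ_0` is a constant, `p^0 − 1 = 0`, so `λ = 0` and `σ = 1`
    subst hn
    have h00 : ((p ^ 0 - 1 : ℕ) : IsLocalRing.ResidueField ℤ_[p]) = 0 := by simp
    rw [h00] at key
    rcases Nat.eq_zero_or_pos (lam Θ) with hl | hl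
    · rw [hl, pow_zero, mul_one] at key
      rw [hl, pow_zero]
      rcases hσ with rfl | rfl
      · rfl
      · exfalso
        push_cast at key
        exact hm1 key
    · rw [zero_pow hl.ne', mul_zero] at key
      exact absurd key zero_ne_one
  · have hM : ((p ^ n - 1 : ℕ) : IsLocalRing.ResidueField ℤ_[p]) = -1 :=
      natCast_pow_sub_one_residueField hn.ne'
    rw [hM] at key
    rcases hσ with rfl | rfl
    · push_cast at key
      rw [one_mul] at key
      exact ((neg_one_pow_eq_one_iff_even hm1).mp key).neg_one_pow
    · push_cast at key
      have key' : (-1 : IsLocalRing.ResidueField ℤ_[p]) ^ (lam Θ + 1) = 1 := by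
        rw [pow_succ, mul_comm]; exact key
      have hev : Even (lam Θ + 1) := (neg_one_pow_eq_one_iff_even hm1).mp key'
      exact (Nat.not_even_iff_odd.mp (Nat.even_add_one.mp hev)).neg_one_pow

end Parity

/-! ## §5. For the newform of an elliptic curve: `σ = −ε_N(f)`, and `= w_E` at the conductor level -/

section Newform

variable {W : WeierstrassCurve ℚ} [W.IsElliptic] [W.IsGloballyMinimal] {N : ℕ} [NeZero N]
  {f : CuspForm (Gamma0 N) 2} {p : ℕ} [hp : Fact p.Prime]

/-- **`(−1)^{λ(θ_n)} = −ε_N(f)` for the newform of an elliptic curve, any level.** For `W / ℚ`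
elliptic and globally minimal, `p` an ODD prime of good reduction (ordinary or supersingular, any
`a_p`), `f ∈ S₂(Γ₀(N))` its newform (`IsNewformOf W f`; Atkin–Lehner: `w_N f = ε f`, `ε = ±1`,
tree theorems `IsNewform0.frickeInvolution_eq_smul_holds`, `frickeEigenvalue_eq_one_or_eq_neg_one_holds`)
and `Θ ∈ Λ` the Mazur–Tate element `θ_n(f)` with `Θ ≠ 0`, `μ(Θ) = 0`: `(−1)^{λ(Θ)} = −ε(f)`.
[cite: Ota2018, Prop. 5.16 and p. 498] -/
theorem neg_one_pow_lam_mazurTate_eq_neg_frickeEigenvalue (hp2 : p ≠ 2) (hf : IsNewformOf W f)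
    (hgood : W.HasGoodReductionAtPrime p) {n : ℕ} {Θ : IwasawaAlgebra p}
    (hΘ : iwasawaToPowerSeries p Θ =
      ((mazurTateElement f p n).map (algebraMap ℚ ℚ_[p]) : PowerSeries ℚ_[p]))
    (hΘ0 : Θ ≠ 0) (hμ : mu Θ = 0) :
    (((-1 : ℤ) ^ lam Θ : ℤ) : ℂ) = -frickeEigenvalue f := by
  have hsm := IsNewform0.frickeInvolution_eq_smul_holds (N := N) (k := (2 : ℤ)) hf.1
  have hFE : IsFrickeEigen N f (frickeEigenvalue f) := isFrickeEigen_of_frickeInvolution_eq_smul N hsm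
  have hpN : ¬ p ∣ N := not_dvd_level_of_isNewformOf hf hgood
  rcases IsNewform0.frickeEigenvalue_eq_one_or_eq_neg_one_holds (N := N) (k := (2 : ℤ)) hf.1 with
    h1 | h1
  · have hW' : IsFrickeEigen N f (-((-1 : ℤ) : ℂ)) := by
      have : (-((-1 : ℤ) : ℂ)) = frickeEigenvalue f := by rw [h1]; push_cast; ring
      rw [this]; exact hFE
    rw [neg_one_pow_lam_mazurTate (Or.inr rfl) hW' hp2 hpN hΘ hΘ0 hμ, h1]; push_cast; ring
  · have hW' : IsFrickeEigen N f (-((1 : ℤ) : ℂ)) := by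
      have : (-((1 : ℤ) : ℂ)) = frickeEigenvalue f := by rw [h1]; push_cast; ring
      rw [this]; exact hFE
    rw [neg_one_pow_lam_mazurTate (Or.inl rfl) hW' hp2 hpN hΘ hΘ0 hμ, h1]; push_cast; ring

/-- **`λ(θ_n) ≡ ord_{s=1} L(E, s) (mod 2)` at the conductor level** ("The \'signs\' in the
functional equations for `L_p(E/ℚ, s)` and `L(E/ℚ, s)` are the same", Greenberg LNM 1716 §5 p. 181 —
here for the Mazur–Tate elements, at every odd good prime, ordinary OR supersingular). For `W / ℚ`
elliptic and globally minimal, `p ≠ 2` good, `f ∈ S₂(Γ₀(N_W))` the newform of `W` at the conductor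
level and `Θ ∈ Λ` the Mazur–Tate element `θ_n(f)` with `Θ ≠ 0`, `μ(Θ) = 0`:
`λ(Θ)` is even iff the analytic rank of `W` is even. Inputs: `neg_one_pow_lam_mazurTate` with
`σ = w_E = −ε(f)` (`rootNumber_eq_neg_frickeEigenvalue`, Hecke) and `Even r_an ↔ w_E = 1`
(`even_analyticRank_iff_of_isNewformOf_conductorLevel`). [cite: Ota2018, Prop. 5.16 and p. 498]
[cite: GreenbergLNM1716, §5 (p. 181)] -/
theorem even_lam_mazurTate_iff_even_analyticRank [NeZero (W.conductorNorm ℤ)]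
    {f : CuspForm (Gamma0 (W.conductorNorm ℤ)) 2} (hp2 : p ≠ 2) (hf : IsNewformOf W f)
    (hgood : W.HasGoodReductionAtPrime p) {n : ℕ} {Θ : IwasawaAlgebra p}
    (hΘ : iwasawaToPowerSeries p Θ =
      ((mazurTateElement f p n).map (algebraMap ℚ ℚ_[p]) : PowerSeries ℚ_[p]))
    (hΘ0 : Θ ≠ 0) (hμ : mu Θ = 0) :
    Even (lam Θ) ↔ Even W.analyticRank := by
  have hw : (W.rootNumber : ℂ) = -frickeEigenvalue f :=
    rootNumber_eq_neg_frickeEigenvalue (fun _ _ ↦ IsNewform0.exists_functional_equation_holds)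
      (fun _ _ ↦ IsNewform0.frickeEigenvalue_eq_one_or_eq_neg_one_holds) hf
  have hpar : Even W.analyticRank ↔ W.rootNumber = 1 :=
    Literature.Barriers.BirchSwinnertonDyer.even_analyticRank_iff_of_isNewformOf_conductorLevel hf
  have key := neg_one_pow_lam_mazurTate_eq_neg_frickeEigenvalue hp2 hf hgood hΘ hΘ0 hμ
  rw [← hw] at key
  have key' : (-1 : ℤ) ^ lam Θ = W.rootNumber := by exact_mod_cast key
  rw [hpar, ← key', neg_one_pow_eq_one_iff_even (by norm_num)]

/-- **Odd analytic rank forces `λ(θ_n)` odd, hence `λ(θ_n) ≥ 1`** (conductor level, `p ≠ 2` good,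
`Θ ≠ 0`, `μ(Θ) = 0`). [cite: Ota2018, Prop. 5.16 and p. 498] -/
theorem odd_lam_mazurTate_of_odd_analyticRank [NeZero (W.conductorNorm ℤ)]
    {f : CuspForm (Gamma0 (W.conductorNorm ℤ)) 2} (hp2 : p ≠ 2) (hf : IsNewformOf W f)
    (hgood : W.HasGoodReductionAtPrime p) {n : ℕ} {Θ : IwasawaAlgebra p}
    (hΘ : iwasawaToPowerSeries p Θ =
      ((mazurTateElement f p n).map (algebraMap ℚ ℚ_[p]) : PowerSeries ℚ_[p]))
    (hΘ0 : Θ ≠ 0) (hμ : mu Θ = 0) (hodd : Odd W.analyticRank) : Odd (lam Θ) := by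
  rw [← Nat.not_even_iff_odd, even_lam_mazurTate_iff_even_analyticRank hp2 hf hgood hΘ hΘ0 hμ,
    Nat.not_even_iff_odd]
  exact hodd

end Newform

end Summit.BirchSwinnertonDyer.Rank1Residual.Supersingular

end
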